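import Literature.NumberTheory.EllipticCurves.HasseWeilAbelian
import Literature.NumberTheory.GaloisRepresentations.GaloisRepFrobeniusProofs
import HarnessLib

/-!
# Hasse–Weil Euler factors at unramified places: discharge of
`Literature.NumberTheory.EllipticCurves.hasseWeilEulerFactor_eq_reverse_frobCharpoly` (trunk EllArithM, item C15 `HasseWeilAbelian`)

D-0014 keeps `Literature/` sorry-free by stating cited results as named facts `def X : Prop`.
This sibling proof file of `Literature.NumberTheory.EllipticCurves.HasseWeilAbelian` proves the
named fact

* `Literature.hasseWeilEulerFactor_eq_reverse_frobCharpoly M ℓ` — *at a finite place `v` of the number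
  field `K` where `V_ℓ M` is unramified, the Hasse–Weil Euler factor
  `L_v(V_ℓ M, T) = det(1 - σ T | (V_ℓ M)_{I_𝔓})` (chosen `𝔓 ∣ v`, chosen arithmetic Frobenius
  `σ`, inertia coinvariants) is `det(1 - Frob_v T | V_ℓ M)`, the reverse of the Frobenius
  characteristic polynomial `GaloisRep.frobCharpoly v`* (Serre, *Abelian ℓ-adic
  representations* (1968), Ch. I §2.3 with §2.1; Serre–Tate (1968), §1),

as `theorem hasseWeilEulerFactor_eq_reverse_frobCharpoly_holds`, for every discrete
`Γ_K`-module `M` (in particular `M = E(K̄)`), through the sharper lemma actually used by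
consumers that already hold a Frobenius characteristic polynomial:

* `Literature.NumberTheory.EllipticCurves.hasseWeilEulerFactor_eq_reverse_of_hasFrobCharpolyAt` — if `V_ℓ M` is unramified at `v`
  and `HasFrobCharpolyAt v P` then `hasseWeilEulerFactor M ℓ h v = P.reverse`.

The other named facts of the parent file (`WeierstrassCurve.hasseWeilEulerFactor_geomPoints`,
`hasRationalEulerFactors_geomPoints`, the `LSeries` link, Ogg–Saito, semisimplicity) are deep
and are not touched here.

## Proof

The parent file's docstring records the argument: "inertia acts trivially, so
`(V_ℓ M)_{I_𝔓} = V_ℓ M`, and all arithmetic Frobenii at all `𝔓 ∣ v` are conjugate".  Formally,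
for a continuous representation `ρ` of `G` on `M` and a prime `𝔓` of a `G`-ring `S`
(`Literature.NumberTheory.GaloisRepresentations.ContinuousRep.InertiaCoinvariants`, Mathlib `Representation.Coinvariants` of
`ρ|_{I_𝔓}`, `I_𝔓 = 𝔓.inertia D_𝔓 ⊴ D_𝔓 = 𝔓.decompositionSubgroup G`):

1. `ContinuousRep.ker_inertiaCoinvariants_eq_bot`: if `I_𝔓 ≤ G` acts trivially
   (`∀ τ ∈ 𝔓.inertia G, ρ τ = 1`, i.e. `GaloisRep.IsUnramifiedAtPrime`), the submodule
   `⟨ρ(τ) m - m⟩` is `⊥` (elements of `𝔓.inertia D_𝔓` lie in `𝔓.inertia G`, Mathlib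
   `Ideal.coe_mem_inertia`);
2. `ContinuousRep.bijective_inertiaCoinvariantsMk`: hence the projection `M → M_{I_𝔓}` is
   bijective, so a linear equivalence `e` (`LinearEquiv.ofBijective`), and the induced action of
   `σ ∈ D_𝔓` on `M_{I_𝔓}` is `e ∘ ρ(σ) ∘ e⁻¹` (`LinearEquiv.conj`);
3. `ContinuousRep.charpoly_toInertiaCoinvariants`: so its characteristic polynomial is
   `charpoly (ρ σ)` (Mathlib `LinearEquiv.charpoly_conj`);
4. for a number field a pair `(𝔓, σ)` with `𝔓 ∣ v` and `σ` an arithmetic Frobenius at `𝔓`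
   exists (`HeightOneSpectrum.primesAbove_nonempty`,
   `exists_isArithFrobAt_of_mem_primesAbove_holds` of `IntegralGaloisActionProofs`), so
   `hasseWeilEulerFactor` takes its non-junk branch, `= (charpoly (ρ σ)).reverse = P.reverse` by
   `HasFrobCharpolyAt v P`; and at an unramified `v`, `HasFrobCharpolyAt v (frobCharpoly v)` is the
   discharged fact `GaloisRep.hasFrobCharpolyAt_frobCharpoly_holds` (`GaloisRepFrobeniusProofs`).

## Design

`noncomputable section`, `open scoped Classical` and `universe u` with `K M : Type u` as in the
parent file; the `ContinuousRep` lemmas are generic (`G`, `A`, `M`, `S` arbitrary, as in the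
parent's section "Inertia coinvariants") and take the `Module.Free/Module.Finite` instances of
both `M` and the coinvariants as instance arguments exactly where `LinearMap.charpoly` needs them
(over the field `ℚ_[ℓ]` they are automatic, `Representation.Coinvariants.instFinite`).
Theorems only (no definitions, no instances): the equivalence `e` of step 2 is produced inside
the proof of `charpoly_toInertiaCoinvariants`.  Mathlib: `Representation.Coinvariants.{ker, mk,
mk_surjective, hom_ext}`, `Representation.toCoinvariants_mk`, `Submodule.span_eq_bot`,
`Submodule.ker_mkQ`, `LinearEquiv.ofBijective`, `LinearEquiv.conj`, `LinearEquiv.charpoly_conj`,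
`Ideal.coe_mem_inertia`, `IsArithFrobAt`.

## References

* J.-P. Serre, *Abelian ℓ-adic representations and elliptic curves* (1968), Ch. I §2.1
  (unramified places, Frobenius, `P_{v,ρ}(T) = det(1 - F_{w,ρ} T)`), §2.3. [SerreAbelianLadic1968]
* J.-P. Serre, J. Tate, *Good reduction of abelian varieties*, Ann. of Math. 88 (1968), §1,
  §2.1, Thm. 3. [SerreTate1968]
* J.-P. Serre, *Facteurs locaux des fonctions zêta des variétés algébriques*, Sém. DPP 1969/70,
  exp. 19, §2.3 (Euler factors via inertia (co)invariants).
-/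

noncomputable section

open scoped Classical NumberField
open Field IsDedekindDomain

universe u

namespace Literature.NumberTheory.EllipticCurves

/-! ### Inertia coinvariants when inertia acts trivially -/

section ContinuousRep
open Literature.NumberTheory.GaloisRepresentations (ContinuousRep)
open Literature.NumberTheory.GaloisRepresentations.ContinuousRep

variable {G : Type*} [Group G] [TopologicalSpace G] {A : Type*} [CommRing A] [TopologicalSpace A]
  {M : Type*} [AddCommGroup M] [Module A M] [TopologicalSpace M]
  {S : Type*} [CommRing S] [MulSemiringAction G S]

/-- If the inertia group `I_𝔓 ≤ G` acts trivially through `ρ` (`∀ τ ∈ 𝔓.inertia G, ρ τ = 1`),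
the submodule `⟨ρ(τ) m - m | τ ∈ I_𝔓 ∩ D_𝔓⟩` defining the inertia coinvariants is trivial
(an element of `𝔓.inertia D_𝔓` lies in `𝔓.inertia G`, Mathlib `Ideal.coe_mem_inertia`).
Serre, *Abelian ℓ-adic representations* (1968), Ch. I §2.1. [folklore] -/
theorem _root_.Literature.NumberTheory.GaloisRepresentations.ContinuousRep.ker_inertiaCoinvariants_eq_bot (ρ : ContinuousRep G A M) (𝔓 : Ideal S)
    (h : ∀ τ ∈ 𝔓.inertia G, ρ τ = 1) :
    Representation.Coinvariants.ker ((ρ.restrictDecomposition 𝔓).comp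
      (𝔓.inertia (𝔓.decompositionSubgroup G)).subtype) = ⊥ := by
  rw [Representation.Coinvariants.ker, Submodule.span_eq_bot]
  rintro _ ⟨⟨τ, m⟩, rfl⟩
  have hτ : ((τ : 𝔓.decompositionSubgroup G) : G) ∈ 𝔓.inertia G :=
    Ideal.coe_mem_inertia.2 τ.2
  simp [h _ hτ]

/-- If inertia acts trivially through `ρ`, the projection `M → M_{I_𝔓}` onto the inertia
coinvariants (Mathlib `Representation.Coinvariants.mk`) is bijective: it is surjective
(`Coinvariants.mk_surjective`) with kernel `ker_inertiaCoinvariants_eq_bot = ⊥`.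
Serre, *Abelian ℓ-adic representations* (1968), Ch. I §2.1 (`V^{I} = V = V_{I}` at unramified
places). [folklore] -/
theorem _root_.Literature.NumberTheory.GaloisRepresentations.ContinuousRep.bijective_inertiaCoinvariantsMk (ρ : ContinuousRep G A M) (𝔓 : Ideal S)
    (h : ∀ τ ∈ 𝔓.inertia G, ρ τ = 1) :
    Function.Bijective (Representation.Coinvariants.mk ((ρ.restrictDecomposition 𝔓).comp
      (𝔓.inertia (𝔓.decompositionSubgroup G)).subtype)) :=
  ⟨by
    rw [← LinearMap.ker_eq_bot]
    exact (Submodule.ker_mkQ _).trans (ρ.ker_inertiaCoinvariants_eq_bot 𝔓 h),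
   Representation.Coinvariants.mk_surjective _⟩

/-- **Inertia coinvariants at an unramified prime do not change characteristic polynomials.**
If inertia acts trivially through `ρ`, then for `σ ∈ D_𝔓` the characteristic polynomial of `σ`
on `M_{I_𝔓}` equals that of `ρ(σ)` on `M`: with `e : M ≃ M_{I_𝔓}` the projection
(`bijective_inertiaCoinvariantsMk`, `LinearEquiv.ofBijective`), the action of `σ` on `M_{I_𝔓}`
is the conjugate `e ∘ ρ(σ) ∘ e⁻¹` (both agree on classes `[m]`, `toInertiaCoinvariants_mk`), and
`charpoly` is invariant under conjugation by an equivalence (Mathlib `LinearEquiv.charpoly_conj`).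
The freeness/finiteness instances are those `LinearMap.charpoly` needs (automatic over a
field).  Serre, *Abelian ℓ-adic representations* (1968), Ch. I §2.1, §2.3. [folklore] -/
theorem _root_.Literature.NumberTheory.GaloisRepresentations.ContinuousRep.charpoly_toInertiaCoinvariants (ρ : ContinuousRep G A M) (𝔓 : Ideal S)
    (h : ∀ τ ∈ 𝔓.inertia G, ρ τ = 1) (σ : 𝔓.decompositionSubgroup G)
    [Module.Free A M] [Module.Finite A M]
    [Module.Free A (ρ.InertiaCoinvariants 𝔓)] [Module.Finite A (ρ.InertiaCoinvariants 𝔓)] :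
    (ρ.toInertiaCoinvariants 𝔓 σ).charpoly = (ρ (σ : G)).charpoly := by
  obtain ⟨e, he⟩ : ∃ e : M ≃ₗ[A] ρ.InertiaCoinvariants 𝔓,
      ∀ m, e m = Representation.Coinvariants.mk _ m :=
    ⟨LinearEquiv.ofBijective _ (ρ.bijective_inertiaCoinvariantsMk 𝔓 h), fun _ => rfl⟩
  have hconj : ρ.toInertiaCoinvariants 𝔓 σ = e.conj (ρ σ) := by
    refine Representation.Coinvariants.hom_ext (LinearMap.ext fun m => ?_)
    simp only [LinearMap.coe_comp, Function.comp_apply, toInertiaCoinvariants_mk,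
      LinearEquiv.conj_apply_apply]
    rw [← he, ← he, LinearEquiv.symm_apply_apply]
  rw [hconj, LinearEquiv.charpoly_conj]

end ContinuousRep

/-! ### Euler factors of `V_ℓ M` at unramified places -/

section Tate

variable {K : Type u} [Field K] (M : Type u) [AddCommGroup M]
  [DistribMulAction (absoluteGaloisGroup K) M] (ℓ : ℕ) [Fact ℓ.Prime]

/-- **Euler factor at an unramified place from a Frobenius characteristic polynomial.**  For a
number field `K`, if `V_ℓ M` is unramified at `v` and every arithmetic Frobenius at every
`𝔓 ∣ v` has characteristic polynomial `P` on `V_ℓ M` (`GaloisRep.HasFrobCharpolyAt v P`), then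
`L_v(V_ℓ M, T) = hasseWeilEulerFactor M ℓ h v` is `P.reverse = "det(1 - Frob_v T)"`: the chosen
pair `(𝔓, σ)` of the definition exists (`primesAbove_nonempty`,
`exists_isArithFrobAt_of_mem_primesAbove_holds`), the coinvariants do not change the
characteristic polynomial (`ContinuousRep.charpoly_toInertiaCoinvariants`), and
`charpoly (ρ σ) = P`.  Serre, *Abelian ℓ-adic representations* (1968), Ch. I §2.1, §2.3;
Serre–Tate (1968), §1. [cite: SerreAbelianLadic1968, Ch. I §2.1 and §2.3] -/
theorem hasseWeilEulerFactor_eq_reverse_of_hasFrobCharpolyAt [NumberField K]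
    (h : Continuous fun x : absoluteGaloisGroup K × RationalTateModule M ℓ ↦
      rationalTateRepresentation (absoluteGaloisGroup K) M ℓ x.1 x.2)
    [Module.Finite ℚ_[ℓ] (RationalTateModule M ℓ)] {v : HeightOneSpectrum (𝓞 K)}
    (hv : (rationalTateGaloisRepOf M ℓ h).IsUnramifiedAt v) {P : Polynomial ℚ_[ℓ]}
    (hP : (rationalTateGaloisRepOf M ℓ h).HasFrobCharpolyAt v P) :
    hasseWeilEulerFactor M ℓ h v = P.reverse := by
  have hex : ∃ 𝔓σ : Ideal (GaloisRepresentations.absIntegers (𝓞 K) K) × absoluteGaloisGroup K,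
      𝔓σ.1 ∈ v.primesAbove ∧ IsArithFrobAt (𝓞 K) 𝔓σ.2 𝔓σ.1 := by
    obtain ⟨𝔓, h𝔓⟩ := HeightOneSpectrum.primesAbove_nonempty v
    obtain ⟨σ, hσ⟩ := HeightOneSpectrum.exists_isArithFrobAt_of_mem_primesAbove_holds h𝔓
    exact ⟨(𝔓, σ), h𝔓, hσ⟩
  rw [hasseWeilEulerFactor, dif_pos hex,
    GaloisRepresentations.ContinuousRep.charpoly_toInertiaCoinvariants _ _ (hv _ hex.choose_spec.1)]
  exact congrArg Polynomial.reverse (hP _ hex.choose_spec.1 _ hex.choose_spec.2)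

/-- **Discharge of `Literature.NumberTheory.EllipticCurves.hasseWeilEulerFactor_eq_reverse_frobCharpoly`.**  At a place `v` of the
number field `K` where `V_ℓ M` is unramified, the Hasse–Weil Euler factor is the reverse of the
Frobenius characteristic polynomial `GaloisRep.frobCharpoly v`:
`hasseWeilEulerFactor_eq_reverse_of_hasFrobCharpolyAt` with
`GaloisRep.hasFrobCharpolyAt_frobCharpoly_holds` (all Frobenii at all `𝔓 ∣ v` have
characteristic polynomial `frobCharpoly v`).  Serre, *Abelian ℓ-adic representations* (1968),
Ch. I §2.3 (with §2.1); Serre–Tate (1968), §1. [cite: SerreTate1968, §1]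
[cite: SerreAbelianLadic1968, Ch. I §2.1 and §2.3] -/
theorem hasseWeilEulerFactor_eq_reverse_frobCharpoly_holds :
    hasseWeilEulerFactor_eq_reverse_frobCharpoly (K := K) M ℓ := by
  intro _ h _ v hv
  exact hasseWeilEulerFactor_eq_reverse_of_hasFrobCharpolyAt M ℓ h hv
    (GaloisRepresentations.GaloisRep.hasFrobCharpolyAt_frobCharpoly_holds hv)

end Tate

end Literature.NumberTheory.EllipticCurves
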